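import Mathlib
import HarnessLib
import Summits.HubbardSuperconductivity.HubbardSuperconductivity.Theorems.KLProgrammeKLRegimeTwoVolumeTowerStepCovZeroFlowAllSteps

/-!
# K3 VL child `KLRegimeVolumeLimitV17F2` (stmt-HubbardSuperconductivity-20440), located item «SCALE-0-STEPCOV», part 4b (FLOW, SECTIONAL): the SECTIONAL data of the
# FIRST step `klStepCov V M β μ K_n 0` — `ScaleCovSecData … Λw Ce₀`, ε-free — at EVERY flow frame `K_n = klFlowFrameU L M β U μ n`, `1 ≤ n ≤ n_β + 1`, on ANY
# lattice `V`, whenever the weight rate satisfies `Λw·4ⁿ ≤ ρ₀`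

Cell `gate-hubbard-kl`, seat p3 (g17).  The sectional twin of part 4a (`…StepCovZeroFlowAllSteps.scaleCovData_klStepCov_zero_flow_all`): the same frame telescope
at scale `0` (p3 g13 `sum_norm_chain_le_of_steps` sampled along a spatial section), base at `K_1` from part 2c (`plainSlice_wt_sectional_le 260`) through part 1's
`secRowWt_klStepCov_zero_le'`, pieces from part 3c (`incrSlice_wt_sectional_le 65`) through part 1's `secRowWt_klStepCov_zero_sub_le`, decaying like `4^{−(1+i)}`.
This is `TowerCrossData.sec` at `j = 0` (DISCHARGER-GUIDE-g14 §1), in the dictionary of the `k ≥ 1` door `scaleCovSecData_klStepCov_flow_all` (p3 g16).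

* **`secRowSumWt_klStepCov_zero_flow`** — `∃ Ce ρ₀ > 0`: every sectional `(1 + Λw·tnorm)`-weighted row of `klStepCov V M β μ K_n 0` is `≤ Ce`;
* **`scaleCovSecData_klStepCov_zero_flow_all`** — the `ScaleCovSecData` door.

Everything is proved; no definitions, no sorry.  Nothing asserts any stub, K3, VL or superconductivity.
[cite: BenfattoGiulianiMastropietro2006, §2.7 (2.66)–(2.67), §2.8 (2.81), §3 (3.2)–(3.8)]
-/

noncomputable section

namespace Summit.HubbardSuperconductivity.HubbardSuperconductivity.Theorems.TorusFourierL2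

set_option linter.dupNamespace false -- summit = problem name (single-conjunct summit), D-0017

open Set Finset Literature.MathematicalPhysics.QuantumLattice Literature.MathematicalPhysics.QuantumLattice.BandSectorCounting
open Literature.MathematicalPhysics.QuantumLattice.FermiRG Literature.Probability.LatticeModels Literature.Analysis.SpecialFunctions
open Summit.HubbardSuperconductivity.HubbardSuperconductivity.Theorems.DispersionFlow
open Summit.HubbardSuperconductivity.HubbardSuperconductivity.Theorems.KLRegimeSplit
open Summit.HubbardSuperconductivity.HubbardSuperconductivity.Theorems.KLProgrammeLegKernels
open Summit.HubbardSuperconductivity.HubbardSuperconductivity.Theorems.PerturbedFermiCurve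
open Summit.HubbardSuperconductivity.HubbardSuperconductivity.Theorems.KLRegimeWick
open Summit.HubbardSuperconductivity.HubbardSuperconductivity.Theorems.TwoVolumeSource
open Summit.HubbardSuperconductivity.HubbardSuperconductivity.Theorems.TwoVolumeDefect
open scoped Real Nat

open Classical

/-! ## §3 The sectional rows and the `ScaleCovSecData` door at scale `0` (ε-free) -/

section Sectional

set_option maxHeartbeats 4000000 in -- long binder lists of the suppliers and the chain bookkeeping
/-- **Sectional rows of `klStepCov V M β μ K_n 0` in the `(1 + Λw·tnorm)` currency, every flow frame, absolute ε-free constant, rate condition `Λw·4ⁿ ≤ ρ₀`**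
(frame telescope at scale `0`, fixed time). [cite: BenfattoGiulianiMastropietro2006, §2.8 (2.81), §3 (3.2)–(3.8)] -/
theorem secRowSumWt_klStepCov_zero_flow :
    ∃ Ce ρ₀ : ℝ, 0 < Ce ∧ 0 < ρ₀ ∧
      ∀ (G : GeoConsts) (P : SplitConsts) (R : RenConsts) (Q : EngConsts) (cc : ℝ), R.WF2 →
      ∀ (μ U : ℝ), 0 < U → U ≤ min (EngineV8.klEngU₀3 P R cc) (1 / (R.Gfr 3 + 1)) →
      ∀ β : ℝ, klBetaMin ≤ β →
      ∀ (L M : ℕ) [NeZero L] [NeZero M],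
      ∀ n : ℕ, 1 ≤ n → n ≤ nScales β + 1 → HistP klPredsV17F2 L M G P Q R β U μ 0 n →
        ∀ (V : ℕ) [NeZero V],
        ∀ Λw : ℝ, 0 ≤ Λw → Λw * (4 : ℝ) ^ n ≤ ρ₀ →
        ∀ (X : SpaceTimeIdx V M × SectorLeg (sectorCount 0)) (t : ImagTimeIdx M) (ℓ : SectorLeg (sectorCount 0)),
          ∑ y : TorusSite 2 V, ‖klStepCov V M β μ (klFlowFrameU L M β U μ n) 0 X ((t, y), ℓ)‖ * (1 + Λw * (Torus.tnorm (X.1.2 - y) : ℝ)) ≤ Ce := by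
  obtain ⟨Ce, se, hCe, hse, -, hbase⟩ := plainSlice_wt_sectional_le 260 (by norm_num)
  obtain ⟨Cf, rf, hCf, hrf, -, hincr⟩ := incrSlice_wt_sectional_le 65 (by norm_num)
  refine ⟨2 * Ce + 2 * Cf / 3, min se rf, by positivity, lt_min hse hrf, ?_⟩
  intro G P R Q cc hR2 μ U hU hUle β hβmin L M _ _ n hn1 hnN hhist V _ Λw hΛw0 hΛwρ X t ℓ
  have hRj : ∀ j, 0 ≤ R.Gfr j := EngineV8.gfr_nonneg_of_wf2 hR2
  have hβ0 : 0 < β := pos_of_klBetaMin_le hβmin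
  have hU₀ : U ≤ EngineV8.klEngU₀3 P R cc := hUle.trans (min_le_left _ _)
  have hUG : U ≤ 1 / (R.Gfr 3 + 1) := hUle.trans (min_le_right _ _)
  have hGU : R.Gfr 3 * U ≤ 1 := by
    have hG3 := hRj 3
    calc R.Gfr 3 * U ≤ R.Gfr 3 * (1 / (R.Gfr 3 + 1)) := mul_le_mul_of_nonneg_left hUG hG3
      _ = R.Gfr 3 / (R.Gfr 3 + 1) := by ring
      _ ≤ 1 := by rw [div_le_one (by positivity)]; linarith only [hG3]
  obtain ⟨hG₀pos, hG₀1⟩ := sumGfr_mul_le_one_of_le_klEngU₀3 P hRj hU hU₀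
  set G₀ : ℝ := (R.Gfr 0 + R.Gfr 1 + R.Gfr 2 + R.Gfr 3 + 1) * U with hG₀def
  have hU1 : U ≤ 1 := by
    have h1 : 1 ≤ R.Gfr 0 + R.Gfr 1 + R.Gfr 2 + R.Gfr 3 + 1 := by linarith [hRj 0, hRj 1, hRj 2, hRj 3]
    nlinarith
  have hh := (histP_klPredsV17F2_iff L M G P Q R β U μ 0 n).1 hhist
  have hJ : ∀ m' < n, FlowPieceJetsAt L M β U μ R m' := fun m' hm' => (hh m' hm').2.1.2.1
  have h4n : (1 : ℝ) ≤ (4 : ℝ) ^ n := one_le_pow₀ (by norm_num)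
  have hΛwρ' : Λw ≤ min se rf := (le_mul_of_one_le_right hΛw0 h4n).trans hΛwρ
  have hΛwb : Λw ≤ 1 * se := by rw [one_mul]; exact hΛwρ'.trans (min_le_left _ _)
  obtain ⟨d, rfl⟩ : ∃ d, n = 1 + d := ⟨n - 1, by omega⟩
  set A : ℕ → Matrix (SpaceTimeIdx V M × SectorLeg (sectorCount 0)) (SpaceTimeIdx V M × SectorLeg (sectorCount 0)) ℂ :=
    fun i => klStepCov V M β μ (klFlowFrameU L M β U μ i) 0 with hAdef
  -- base
  have hK1 : FrameOK R U (nScales β) μ (klFlowFrameU L M β U μ 1) := frameOK_klFlowFrameU_of_histP_le hR2 le_rfl hn1 (by omega) hhist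
  have hK3base : ∀ p : Momentum, ‖iteratedFDeriv ℝ 3 (frameLevel μ (klFlowFrameU L M β U μ 1)) p‖ ≤ 260 := fun p => by
    have h := third_deriv_frameLevel_klFlowFrameU_le_scaled (L := L) (M := M) (β := β) (μ := μ) hRj hU.le hU1 hGU (m := 1)
      (fun m' hm' => hJ m' (by omega)) p
    norm_num at h
    exact h
  have hTb := hbase V M R U (nScales β) μ (klFlowFrameU L M β U μ 1) hK1 hK3base β hβmin
  have hTb' : ∀ z₁ : TorusSite 1 (2 * M), ∑ z₂ : TorusSite 2 V, (1 + Λw * (Torus.tnorm z₂ : ℝ)) *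
      ‖∑ q : TorusSite 1 (2 * M) × TorusSite 2 V, (torusChar q.1 z₁ * torusChar q.2 z₂) •
        ((((1 / (β * (V : ℝ) ^ 2) : ℝ) : ℂ) ^ 2 *
          sliceSymbolFnXi (β * (V : ℝ) ^ 2) 0 (klScale klE0 2) (klScale klE0 1) (matsubaraFreq β M ⟨(q.1 0).val, ZMod.val_lt (q.1 0)⟩)
            (nambuXiCT V μ (klFlowFrameU L M β U μ 1) q.2)))‖ ≤ Ce := fun z₁ => by
    refine le_trans (Finset.sum_le_sum fun z₂ _ => mul_le_mul_of_nonneg_right ?_ (norm_nonneg _)) (hTb z₁)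
    have h := one_add_mul_tnorm_le_mul_rateWt (L := V) le_rfl hΛw0 hΛwb z₂
    rw [one_mul] at h
    exact h
  -- pieces
  have hpiece : ∀ i < d, ∀ z₁ : TorusSite 1 (2 * M), ∑ z₂ : TorusSite 2 V, (1 + Λw * (Torus.tnorm z₂ : ℝ)) *
      ‖∑ q : TorusSite 1 (2 * M) × TorusSite 2 V, (torusChar q.1 z₁ * torusChar q.2 z₂) •
        ((((1 / (β * (V : ℝ) ^ 2) : ℝ) : ℂ) ^ 2 *
          (sliceSymbolFnXi (β * (V : ℝ) ^ 2) 0 (klScale klE0 2) (klScale klE0 1) (matsubaraFreq β M ⟨(q.1 0).val, ZMod.val_lt (q.1 0)⟩)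
              (nambuXiCT V μ (klFlowFrameU L M β U μ (1 + i + 1)) q.2) -
            sliceSymbolFnXi (β * (V : ℝ) ^ 2) 0 (klScale klE0 2) (klScale klE0 1) (matsubaraFreq β M ⟨(q.1 0).val, ZMod.val_lt (q.1 0)⟩)
              (nambuXiCT V μ (klFlowFrameU L M β U μ (1 + i)) q.2))))‖ ≤ Cf * (G₀ / (4 : ℝ) ^ (1 + i)) := by
    intro i hi z₁
    obtain ⟨hfr1, hfr2, -, -, -, -, hJi, -⟩ := thinPair_flow_frames hR2 hnN hhist (i := 1 + i) (by omega) (by omega)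
    have hx : (1 : ℝ) ≤ (4 : ℝ) ^ (1 + i) := one_le_pow₀ (by norm_num)
    have hK3 : ∀ p : Momentum, ‖iteratedFDeriv ℝ 3 (frameLevel μ (klFlowFrameU L M β U μ (1 + i))) p‖ ≤ 65 * (4 : ℝ) ^ (1 + i) := fun p =>
      third_deriv_frameLevel_klFlowFrameU_le_scaled (L := L) (M := M) (β := β) (μ := μ) hRj hU.le hU1 hGU (fun m' hm' => hJ m' (by omega)) p
    obtain ⟨hw₀, hw₁, hw₂, hw₃⟩ := flowPiece_increment_jets_G₀ (L := L) (M := M) (μ := μ) hRj hU hU1 hJi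
    have hT := hincr V M R U (nScales β) R U (nScales β) μ (klFlowFrameU L M β U μ (1 + i)) (klFlowFrameU L M β U μ (1 + i + 1)) hfr1 hfr2
      G₀ ((4 : ℝ) ^ (1 + i)) hG₀pos.le hG₀1 hx hK3 hw₀ hw₁ hw₂ hw₃ β hβmin z₁
    refine le_trans (Finset.sum_le_sum fun z₂ _ => mul_le_mul_of_nonneg_right ?_ (norm_nonneg _)) hT
    have hΛwi : Λw ≤ 1 * (rf / (4 : ℝ) ^ (1 + i)) := by
      rw [one_mul, le_div_iff₀ (by positivity)]
      have h1 : Λw * (4 : ℝ) ^ (1 + i) ≤ Λw * (4 : ℝ) ^ (1 + d) :=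
        mul_le_mul_of_nonneg_left (pow_le_pow_right₀ (by norm_num) (by omega)) hΛw0
      exact h1.trans (hΛwρ.trans (min_le_right _ _))
    have h := one_add_mul_tnorm_le_mul_rateWt (L := V) le_rfl hΛw0 hΛwi z₂
    rw [one_mul] at h
    exact h
  have hsum : ∑ i ∈ range d, 2 * (Cf * (G₀ / (4 : ℝ) ^ (1 + i))) ≤ 2 * Cf / 3 := by
    have e : ∑ i ∈ range d, 2 * (Cf * (G₀ / (4 : ℝ) ^ (1 + i))) = 2 * Cf * G₀ * ∑ i ∈ range d, ((4 : ℝ) ^ (1 + i))⁻¹ := by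
      rw [Finset.mul_sum]; exact Finset.sum_congr rfl fun i _ => by rw [div_eq_mul_inv]; ring
    rw [e]
    have hg := geom_quarter_tail_le d
    calc 2 * Cf * G₀ * ∑ i ∈ range d, ((4 : ℝ) ^ (1 + i))⁻¹ ≤ 2 * Cf * 1 * (1 / 3) := by
          gcongr
      _ = 2 * Cf / 3 := by ring
  have hwev : ∀ b : TorusSite 2 V, (fun z : TorusSite 2 V => 1 + Λw * (Torus.tnorm z : ℝ)) (-b) = (fun z : TorusSite 2 V => 1 + Λw * (Torus.tnorm z : ℝ)) b :=
    fun b => one_add_mul_tnorm_neg Λw b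
  have hw0 : ∀ z : TorusSite 2 V, 0 ≤ (fun z : TorusSite 2 V => 1 + Λw * (Torus.tnorm z : ℝ)) z := fun z => by positivity
  have hchain := sum_norm_chain_le_of_steps A (univ : Finset (TorusSite 2 V)) (fun _ => X) (fun y => ((t, y), ℓ))
    (fun y => 1 + Λw * (Torus.tnorm (X.1.2 - y) : ℝ)) (fun y => by positivity) 1 d
    (fun i => 2 * (Cf * (G₀ / (4 : ℝ) ^ (1 + i)))) (fun i hi => by
      simp only [hAdef]
      exact secRowWt_klStepCov_zero_sub_le hβ0.ne' μ _ _ _ hw0 hwev (hpiece i hi) X t ℓ)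
  have hb := secRowWt_klStepCov_zero_le' (V := V) (M := M) hβ0.ne' μ (klFlowFrameU L M β U μ 1) _ hw0 hwev hTb' X t ℓ
  simp only [hAdef] at hchain hb
  calc _ ≤ _ := hchain
    _ ≤ 2 * Ce + 2 * Cf / 3 := add_le_add hb hsum

set_option maxHeartbeats 800000 in -- long binder list
/-- **THE SECTIONAL DATA OF THE FIRST STEP AT EVERY FLOW FRAME** (located item «SCALE-0-STEPCOV», `TowerCrossData.sec` at `j = 0`): `∃ Ce₀ ρ₀ > 0`, for every history
(`1 ≤ n ≤ n_β + 1`), every lattice `V`, every `0 ≤ Λw` with `Λw·4ⁿ ≤ ρ₀`: `ScaleCovSecData (klStepCov V M β μ (klFlowFrameU L M β U μ n) 0) Λw Ce₀` (ε-free).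
[cite: BenfattoGiulianiMastropietro2006, §2.8 (2.81), §3 (3.2)–(3.8)] -/
theorem scaleCovSecData_klStepCov_zero_flow_all :
    ∃ Ce₀ ρ₀ : ℝ, 0 < Ce₀ ∧ 0 < ρ₀ ∧
      ∀ (G : GeoConsts) (P : SplitConsts) (R : RenConsts) (Q : EngConsts) (cc : ℝ), R.WF2 →
      ∀ (μ U : ℝ), 0 < U → U ≤ min (EngineV8.klEngU₀3 P R cc) (1 / (R.Gfr 3 + 1)) →
      ∀ β : ℝ, klBetaMin ≤ β →
      ∀ (L M : ℕ) [NeZero L] [NeZero M],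
      ∀ n : ℕ, 1 ≤ n → n ≤ nScales β + 1 → HistP klPredsV17F2 L M G P Q R β U μ 0 n →
        ∀ (V : ℕ) [NeZero V],
        ∀ Λw : ℝ, 0 ≤ Λw → Λw * (4 : ℝ) ^ n ≤ ρ₀ →
          ScaleCovSecData (klStepCov V M β μ (klFlowFrameU L M β U μ n) 0) Λw Ce₀ := by
  obtain ⟨Ce, ρ₀, hCe, hρ₀, h⟩ := secRowSumWt_klStepCov_zero_flow
  refine ⟨Ce, ρ₀, hCe, hρ₀, ?_⟩
  intro G P R Q cc hR2 μ U hU hUle β hβmin L M _ _ n hn1 hnN hhist V _ Λw hΛw0 hΛwρ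
  exact ⟨fun X t ℓ => h G P R Q cc hR2 μ U hU hUle β hβmin L M n hn1 hnN hhist V Λw hΛw0 hΛwρ X t ℓ⟩

end Sectional

end Summit.HubbardSuperconductivity.HubbardSuperconductivity.Theorems.TorusFourierL2

end
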